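import Mathlib.Topology.ContinuousMap.Weierstrass
import Literature.Analysis.SpecialFunctions.JacobiHeatOrder
import HarnessLib

/-!
# Small-time behaviour of the Jacobi heat series with initial datum `z^{1-c}`

Topic `Literature/Analysis/SpecialFunctions` (generic). Sequel of `JacobiHeatOrder.lean`
(duality and order properties of the Jacobi heat series `Y = initHeat c μ` of the datum `z^{1-c}`,
`1 < c < 2`, `μ > 0`); motivation: the probabilistic (renewal) representation of the explicit
solution `u(θ, t) = e^{-λt} sin(θ/4)^q Y(sin²(θ/4), t)` of LSW's boundary problem behind
`Literature.Probability.Percolation.LawlerSchrammWerner2002_hittingPDE` (LSW (2002), Lemma 2.2,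
(2.2), (2.10)) needs the **initial condition in the interior**: `u(·, t) → 1` as `t ↓ 0`, locally
uniformly on `(0, 2π]`, i.e. `Y(z, t) → z^{1-c}` locally uniformly on `(0, 1]`. We prove it by the
duality of `JacobiHeatOrder.lean`, without any pointwise convergence of the eigenfunction expansion
at `t = 0`:

* `integral_jacobiWeight_jacobiHeatFin_mul_hypJacobi`, `integral_jacobiWeight_jacobiHeatFin_symm`
  — the finite heat flow `V_b = jacobiHeatFin c μ b N` is symmetric in `L²(ρ)`:
  `∫₀¹ ρ V_b(·,t) V_{b'}(·,0) = ∫₀¹ ρ V_b(·,0) V_{b'}(·,t)` (orthogonality of the `y_n`);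
* `jacobiHeatFin_le_initHeat` — **order for polynomial sub-data**: if `V_b(·, 0) ≤ z^{1-c}` on
  `(0, 1]` then `V_b(z, t) ≤ Y(z, t)` for `t > 0`, `z ∈ (0, 1]` (duality
  `∫ ρ Y(·,t) V_{b'}(·,0) = ∫ (1-z)^{1-c} V_{b'}(·,t)`, symmetry, positivity preservation of the
  finite flow, and `nonneg_on_Ioc_of_duality`);
* `exists_sub_le_initHeat` — **small-time lower bound**: for `a > 0` and `η > 0` there is
  `t₀ > 0` with `z^{1-c} - η ≤ Y(z, t)` for `t ∈ (0, t₀)`, `z ∈ [a, 1]` (Weierstrass approximation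
  of `min{z^{1-c}, a^{1-c}}` from below by a polynomial, expanded in the `y_n`, and uniform
  continuity of the finite flow on `[0, 1] × [0, 1]`);
* `tendstoUniformlyOn_initHeat` — hence, with the upper bound `Y(z, t) ≤ e^{λ₀ t} z^{1-c}`
  (`exp_mul_initHeat_le`), `Y(·, t) → z^{1-c}` uniformly on `[a, 1]` as `t ↓ 0`.

No named fact is introduced.

## References

* G. F. Lawler, O. Schramm, W. Werner, *One-arm exponent for critical 2D percolation*, Electron.
  J. Probab. 7 (2002), no. 2, Lemma 2.2, (2.2), (2.10). [LawlerSchrammWernerEJP2002]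
* G. E. Andrews, R. Askey, R. Roy, *Special Functions*, CUP (1999), (2.5.14). [AndrewsAskeyRoy1999]

## Mathlib / tree

Mathlib: `exists_polynomial_near_of_continuousOn` (Weierstrass), `IsCompact.uniformContinuousOn_of_continuous`,
`Real.rpow_le_rpow_of_nonpos`. Tree: `integral_initHeat_duality`, `nonneg_on_Ioc_of_duality`,
`jacobiHeatFin_nonneg`, `integral_jacobiWeight_hypJacobi_mul_hypJacobi`,
`exists_eval_eq_sum_hypJacobi`, `exp_mul_initHeat_le`.
-/

noncomputable section

open Polynomial Set MeasureTheory intervalIntegral Filter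
open scoped Topology

namespace Literature.Analysis.SpecialFunctions

section SmallTime

variable {c μ : ℝ} (hc : 1 < c) (hc2 : c < 2) (hμ : 0 < μ)
include hc hc2 hμ

/-! ### Symmetry of the finite heat flow in `L²(ρ)` -/

omit hμ in
/-- `∫₀¹ ρ V_b(·,t) y_m = b_m e^{-μ m(m+1) t} h_m` if `m < N`, and `0` otherwise (orthogonality).
[folklore] -/
theorem integral_jacobiWeight_jacobiHeatFin_mul_hypJacobi (b : ℕ → ℝ) (N : ℕ) (t : ℝ) (m : ℕ) :
    ∫ z in (0 : ℝ)..1, jacobiWeight c z * (jacobiHeatFin c μ b N z t * (hypJacobi c m).eval z)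
      = if m < N then b m * Real.exp (-(μ * m * (m + 1) * t)) * hypJacobiNormSq c m else 0 := by
  have e : ∀ z, jacobiWeight c z * (jacobiHeatFin c μ b N z t * (hypJacobi c m).eval z)
      = ∑ n ∈ Finset.range N, b n * Real.exp (-(μ * n * (n + 1) * t))
          * (jacobiWeight c z * ((hypJacobi c n).eval z * (hypJacobi c m).eval z)) := fun z => by
    rw [jacobiHeatFin, Finset.sum_mul, Finset.mul_sum]
    exact Finset.sum_congr rfl fun n _ => by ring
  simp_rw [e]
  rw [intervalIntegral.integral_finsetSum]
  · simp_rw [intervalIntegral.integral_const_mul]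
    split_ifs with hm
    · rw [Finset.sum_eq_single m]
      · rw [hypJacobiNormSq]
        congr 1
        exact intervalIntegral.integral_congr fun z _ => by ring
      · intro n _ hnm
        rw [integral_jacobiWeight_hypJacobi_mul_hypJacobi hc hc2 hnm, mul_zero]
      · intro h; exact absurd (Finset.mem_range.2 hm) h
    · refine Finset.sum_eq_zero fun n hn => ?_
      have hnm : n ≠ m := fun h => hm (h ▸ Finset.mem_range.1 hn)
      rw [integral_jacobiWeight_hypJacobi_mul_hypJacobi hc hc2 hnm, mul_zero]
  · intro n _
    exact (intervalIntegrable_jacobiWeight_mul hc.le hc2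
      ((continuous_hypJacobi_eval c n).mul (continuous_hypJacobi_eval c m))).const_mul _

omit hμ in
/-- **Symmetry of the finite semigroup**: `∫₀¹ ρ V_b(·,t) V_{b'}(·,0) = ∫₀¹ ρ V_b(·,0) V_{b'}(·,t)`.
[folklore] -/
theorem integral_jacobiWeight_jacobiHeatFin_symm (b b' : ℕ → ℝ) (N N' : ℕ) (t : ℝ) :
    ∫ z in (0 : ℝ)..1, jacobiWeight c z * jacobiHeatFin c μ b N z t * jacobiHeatFin c μ b' N' z 0
      = ∫ z in (0 : ℝ)..1, jacobiWeight c z * jacobiHeatFin c μ b N z 0 * jacobiHeatFin c μ b' N' z t := by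
  -- expand `V_{b'}` on both sides
  have e : ∀ s s' z, jacobiWeight c z * jacobiHeatFin c μ b N z s * jacobiHeatFin c μ b' N' z s'
      = ∑ m ∈ Finset.range N', b' m * Real.exp (-(μ * m * (m + 1) * s'))
          * (jacobiWeight c z * (jacobiHeatFin c μ b N z s * (hypJacobi c m).eval z)) := by
    intro s s' z
    rw [show jacobiHeatFin c μ b' N' z s' = ∑ m ∈ Finset.range N',
      b' m * Real.exp (-(μ * m * (m + 1) * s')) * (hypJacobi c m).eval z from rfl, Finset.mul_sum]
    exact Finset.sum_congr rfl fun m _ => by ring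
  have hint : ∀ s s', IntervalIntegrable (fun z => jacobiWeight c z * (jacobiHeatFin c μ b N z s
      * (hypJacobi c s').eval z)) volume 0 1 := fun s s' =>
    intervalIntegrable_jacobiWeight_mul hc.le hc2
      (((continuous_jacobiHeatFin c μ b N).comp (Continuous.prodMk_left s)).mul
        (continuous_hypJacobi_eval c s'))
  simp_rw [e t 0, e 0 t]
  rw [intervalIntegral.integral_finsetSum (fun m _ => (hint t m).const_mul _),
    intervalIntegral.integral_finsetSum (fun m _ => (hint 0 m).const_mul _)]
  refine Finset.sum_congr rfl fun m _ => ?_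
  rw [intervalIntegral.integral_const_mul, intervalIntegral.integral_const_mul,
    integral_jacobiWeight_jacobiHeatFin_mul_hypJacobi hc hc2 b N t m,
    integral_jacobiWeight_jacobiHeatFin_mul_hypJacobi hc hc2 b N 0 m]
  split_ifs
  · ring
  · ring

/-! ### Order for polynomial sub-data -/

/-- **Order for polynomial sub-data**: if the polynomial datum `V_b(·, 0) = Σ_{n<N} b_n y_n` lies
below the datum `z^{1-c}` of `Y` on `(0, 1]`, then `V_b(z, t) ≤ Y(z, t)` for all `t > 0`,
`z ∈ (0, 1]`. By duality: for every `b'` with `V_{b'}(·,0) ≥ 0`,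
`∫ ρ (Y - V_b)(·,t) V_{b'}(·,0) = ∫ ρ (z^{1-c} - V_b(·,0)) V_{b'}(·,t) ≥ 0`. [folklore] -/
theorem jacobiHeatFin_le_initHeat (b : ℕ → ℝ) (N : ℕ)
    (hb : ∀ z ∈ Ioc (0 : ℝ) 1, jacobiHeatFin c μ b N z 0 ≤ z ^ (1 - c))
    {t : ℝ} (ht : 0 < t) {z : ℝ} (hz : z ∈ Ioc (0 : ℝ) 1) :
    jacobiHeatFin c μ b N z t ≤ initHeat c μ z t := by
  have hVct : Continuous fun z => jacobiHeatFin c μ b N z t :=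
    (continuous_jacobiHeatFin c μ b N).comp (Continuous.prodMk_left t)
  have hVc0 : Continuous fun z => jacobiHeatFin c μ b N z 0 :=
    (continuous_jacobiHeatFin c μ b N).comp (Continuous.prodMk_left 0)
  have h := nonneg_on_Ioc_of_duality (μ := μ) hc hc2
    (F := fun z => initHeat c μ z t - jacobiHeatFin c μ b N z t)
    ((continuousOn_initHeat hc hc2 hμ ht).sub hVct.continuousOn) ?_ ?_ hz
  · linarith
  · have h1 := intervalIntegrable_weight_initHeat_mul hc hc2 hμ ht continuous_const (g := fun _ => 1)
    have h2 := intervalIntegrable_jacobiWeight_mul hc.le hc2 hVct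
    refine (h1.sub h2).congr fun z _ => ?_
    show jacobiWeight c z * initHeat c μ z t * 1 - jacobiWeight c z * jacobiHeatFin c μ b N z t = _
    ring
  · intro b' N' hb'
    have hV'c0 : Continuous fun z => jacobiHeatFin c μ b' N' z 0 :=
      (continuous_jacobiHeatFin c μ b' N').comp (Continuous.prodMk_left 0)
    have hV'ct : Continuous fun z => jacobiHeatFin c μ b' N' z t :=
      (continuous_jacobiHeatFin c μ b' N').comp (Continuous.prodMk_left t)
    have hi1 := intervalIntegrable_weight_initHeat_mul hc hc2 hμ ht hV'c0
    have hi2 := intervalIntegrable_jacobiWeight_mul hc.le hc2 (hVct.mul hV'c0)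
    have hsplit : ∫ z in (0 : ℝ)..1, jacobiWeight c z * (initHeat c μ z t - jacobiHeatFin c μ b N z t)
          * jacobiHeatFin c μ b' N' z 0
        = (∫ z in (0 : ℝ)..1, jacobiWeight c z * initHeat c μ z t * jacobiHeatFin c μ b' N' z 0)
          - ∫ z in (0 : ℝ)..1, jacobiWeight c z * jacobiHeatFin c μ b N z t
              * jacobiHeatFin c μ b' N' z 0 := by
      rw [← intervalIntegral.integral_sub hi1 (hi2.congr fun z _ => by simp only [Pi.mul_apply]; ring)]
      exact intervalIntegral.integral_congr fun z _ => by ring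
    -- `W_{b'}(t) = ∫ ρ z^{1-c} V_{b'}(t)`
    have hW : weightedIntegral c μ b' N' t
        = ∫ z in (0 : ℝ)..1, jacobiWeight c z * z ^ (1 - c) * jacobiHeatFin c μ b' N' z t := by
      rw [weightedIntegral]
      refine intervalIntegral.integral_congr_ae (ae_of_all _ fun z hz => ?_)
      rw [uIoc_of_le zero_le_one] at hz
      rw [jacobiWeight, show z ^ (c - 1) * (1 - z) ^ (1 - c) * z ^ (1 - c)
        = (z ^ (c - 1) * z ^ (1 - c)) * (1 - z) ^ (1 - c) by ring, ← Real.rpow_add hz.1,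
        show c - 1 + (1 - c) = 0 by ring, Real.rpow_zero, one_mul]
    have hi3 : IntervalIntegrable (fun z => jacobiWeight c z * z ^ (1 - c) * jacobiHeatFin c μ b' N' z t)
        volume 0 1 := by
      refine ((intervalIntegrable_one_sub_rpow hc2).mul_continuousOn hV'ct.continuousOn).congr
        fun z hz => ?_
      rw [uIoc_of_le zero_le_one] at hz
      show (1 - z) ^ (1 - c) * jacobiHeatFin c μ b' N' z t = _
      rw [jacobiWeight, show z ^ (c - 1) * (1 - z) ^ (1 - c) * z ^ (1 - c)
        = (z ^ (c - 1) * z ^ (1 - c)) * (1 - z) ^ (1 - c) by ring, ← Real.rpow_add hz.1,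
        show c - 1 + (1 - c) = 0 by ring, Real.rpow_zero, one_mul]
    have hi4 := intervalIntegrable_jacobiWeight_mul hc.le hc2 (hVc0.mul hV'ct)
    rw [hsplit, integral_initHeat_duality hc hc2 hμ ht,
      integral_jacobiWeight_jacobiHeatFin_symm hc hc2 b b' N N' t, hW,
      ← intervalIntegral.integral_sub hi3 (hi4.congr fun z _ => by simp only [Pi.mul_apply]; ring)]
    refine intervalIntegral.integral_nonneg zero_le_one fun z hz => ?_
    have hρ : 0 ≤ jacobiWeight c z := jacobiWeight_nonneg c hz
    have hV' : 0 ≤ jacobiHeatFin c μ b' N' z t :=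
      jacobiHeatFin_nonneg hc hc2 b' N' hμ.le (fun z _ => hb' z) ht.le hz
    have key : jacobiWeight c z * z ^ (1 - c) * jacobiHeatFin c μ b' N' z t
        - jacobiWeight c z * jacobiHeatFin c μ b N z 0 * jacobiHeatFin c μ b' N' z t
        = jacobiWeight c z * (z ^ (1 - c) - jacobiHeatFin c μ b N z 0) * jacobiHeatFin c μ b' N' z t := by
      ring
    rw [key]
    rcases hz.1.eq_or_lt with h0 | h0
    · -- at `z = 0` the weight vanishes
      subst h0
      rw [jacobiWeight, Real.zero_rpow (by linarith), zero_mul, zero_mul, zero_mul]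
    · have hd : 0 ≤ z ^ (1 - c) - jacobiHeatFin c μ b N z 0 := sub_nonneg.2 (hb z ⟨h0, hz.2⟩)
      exact mul_nonneg (mul_nonneg hρ hd) hV'

/-! ### The small-time lower bound -/

omit hc2 hμ in
/-- `(max z a)^{1-c} ≤ z^{1-c}` for `0 < z` (`a > 0`, `c > 1`). [folklore] -/
theorem max_rpow_le_rpow {a z : ℝ} (hz : 0 < z) : (max z a) ^ (1 - c) ≤ z ^ (1 - c) :=
  Real.rpow_le_rpow_of_nonpos hz (le_max_left z a) (by linarith)

/-- **Small-time lower bound for `Y`**: for `a > 0` and `η > 0` there is `t₀ > 0` such that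
`z^{1-c} - η ≤ Y(z, t)` for all `t ∈ (0, t₀)` and `z ∈ [a, 1]` (`a > 0`). Proof: approximate the continuous
function `g(z) = (max{z, a})^{1-c} ≤ z^{1-c}` uniformly on `[0, 1]` from below by a polynomial
`p = Σ b_n y_n` (Weierstrass), apply `jacobiHeatFin_le_initHeat` and the uniform continuity of the
finite flow `V_b` on `[0, 1] × [0, 1]`. [folklore] -/
theorem exists_sub_le_initHeat {a : ℝ} (ha : 0 < a) {η : ℝ} (hη : 0 < η) :
    ∃ t₀ : ℝ, 0 < t₀ ∧ ∀ t ∈ Ioo 0 t₀, ∀ z ∈ Icc a 1, z ^ (1 - c) - η ≤ initHeat c μ z t := by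
  have hck : ∀ k : ℕ, (k : ℝ) + c ≠ 0 := fun k => by positivity
  -- the continuous minorant `g`
  set g : ℝ → ℝ := fun z => (max z a) ^ (1 - c) with hg
  have hgc : Continuous g := by
    refine (continuous_id.max continuous_const).rpow_const fun z => Or.inl ?_
    exact (lt_of_lt_of_le ha (le_max_right z a)).ne'
  -- Weierstrass: `|p - g| < η/3` on `[0, 1]`; shift down by `η/3`
  obtain ⟨p, hp⟩ := exists_polynomial_near_of_continuousOn 0 1 g hgc.continuousOn (η / 3)
    (by positivity)
  set p' : ℝ[X] := p - C (η / 3) with hp'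
  have hp'eval : ∀ z, p'.eval z = p.eval z - η / 3 := fun z => by simp [hp']
  have hp'le : ∀ z ∈ Icc (0 : ℝ) 1, p'.eval z ≤ g z := fun z hz => by
    have := (abs_lt.1 (hp z hz)).2; rw [hp'eval]; linarith
  have hp'ge : ∀ z ∈ Icc (0 : ℝ) 1, g z - 2 * (η / 3) ≤ p'.eval z := fun z hz => by
    have := (abs_lt.1 (hp z hz)).1; rw [hp'eval]; linarith
  -- expand `p'` in the `y_n`
  obtain ⟨d, b, hb⟩ := exists_eval_eq_sum_hypJacobi hck p'
  have hV0 : ∀ z, jacobiHeatFin c μ b (d + 1) z 0 = p'.eval z := fun z => by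
    rw [hb z, jacobiHeatFin]
    refine Finset.sum_congr rfl fun n _ => ?_
    simp
  have hVsub : ∀ z ∈ Ioc (0 : ℝ) 1, jacobiHeatFin c μ b (d + 1) z 0 ≤ z ^ (1 - c) := fun z hz => by
    rw [hV0]
    exact (hp'le z ⟨hz.1.le, hz.2⟩).trans (max_rpow_le_rpow hc hz.1)
  -- uniform continuity of `V_b` on `[0,1] × [0,1]`
  have hVc : Continuous fun q : ℝ × ℝ => jacobiHeatFin c μ b (d + 1) q.1 q.2 :=
    continuous_jacobiHeatFin c μ b (d + 1)
  have hK : IsCompact (Icc (0 : ℝ) 1 ×ˢ Icc (0 : ℝ) 1) := isCompact_Icc.prod isCompact_Icc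
  have hU := Metric.uniformContinuousOn_iff.1 (hK.uniformContinuousOn_of_continuous hVc.continuousOn)
    (η / 3) (by positivity)
  obtain ⟨δ, hδ, hUδ⟩ := hU
  refine ⟨min δ 1, lt_min hδ one_pos, fun t ht z hz => ?_⟩
  have ht1 : t ∈ Icc (0 : ℝ) 1 := ⟨ht.1.le, (ht.2.trans_le (min_le_right _ _)).le⟩
  have hz01 : z ∈ Icc (0 : ℝ) 1 := ⟨ha.le.trans hz.1, hz.2⟩
  have hzIoc : z ∈ Ioc (0 : ℝ) 1 := ⟨ha.trans_le hz.1, hz.2⟩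
  -- `|V_b(z,t) - V_b(z,0)| < η/3`
  have hclose : dist (jacobiHeatFin c μ b (d + 1) z t) (jacobiHeatFin c μ b (d + 1) z 0) < η / 3 := by
    refine hUδ (z, t) ⟨hz01, ht1⟩ (z, 0) ⟨hz01, ⟨le_rfl, zero_le_one⟩⟩ ?_
    rw [Prod.dist_eq, dist_self, Real.dist_eq, sub_zero, abs_of_pos ht.1, max_lt_iff]
    exact ⟨hδ, ht.2.trans_le (min_le_left _ _)⟩
  have hY := jacobiHeatFin_le_initHeat hc hc2 hμ b (d + 1) hVsub ht.1 hzIoc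
  have hgz : g z = z ^ (1 - c) := by
    simp only [hg, max_eq_left hz.1]
  have h1 : g z - 2 * (η / 3) ≤ jacobiHeatFin c μ b (d + 1) z 0 := (hV0 z).symm ▸ hp'ge z hz01
  have h2 := (abs_lt.1 (Real.dist_eq _ _ ▸ hclose)).1
  linarith

/-- **`Y(·, t) → z^{1-c}` uniformly on `[a, 1]` as `t ↓ 0`** (`a > 0`): the lower bound
`exists_sub_le_initHeat` and the upper bound `Y(z, t) ≤ e^{λ₀ t} z^{1-c}` (`exp_mul_initHeat_le`,
`λ₀ = μ(c-1)(2-c)`). This is the initial condition `u(·, 0+) = 1` of LSW's boundary problem in the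
interior, for the explicit series solution. [cite: LawlerSchrammWernerEJP2002, Lemma 2.2, (2.2)] -/
theorem tendstoUniformlyOn_initHeat {a : ℝ} (ha : 0 < a) :
    TendstoUniformlyOn (fun t z => initHeat c μ z t) (fun z => z ^ (1 - c)) (𝓝[>] 0) (Icc a 1) := by
  rw [Metric.tendstoUniformlyOn_iff]
  intro η hη
  -- constants: `z^{1-c} ≤ a^{1-c}` on `[a, 1]`
  set M : ℝ := a ^ (1 - c) with hM
  have hM0 : 0 < M := Real.rpow_pos_of_pos ha _
  have hzle : ∀ z ∈ Icc a 1, z ^ (1 - c) ≤ M := fun z hz =>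
    Real.rpow_le_rpow_of_nonpos ha hz.1 (by linarith)
  have hzpos : ∀ z ∈ Icc a 1, 0 < z ^ (1 - c) := fun z hz => Real.rpow_pos_of_pos (ha.trans_le hz.1) _
  -- lower bound
  obtain ⟨t₀, ht₀, hlow⟩ := exists_sub_le_initHeat hc hc2 hμ ha (half_pos hη)
  -- upper bound: `e^{λ₀ t} ≤ 1 + η/(2M)` for small `t`
  set lam : ℝ := μ * (c - 1) * (2 - c) with hlam
  have hexp : Tendsto (fun t : ℝ => Real.exp (lam * t)) (𝓝[>] 0) (𝓝 1) := by
    have h : Tendsto (fun t : ℝ => Real.exp (lam * t)) (𝓝 0) (𝓝 (Real.exp (lam * 0))) :=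
      (Real.continuous_exp.comp (continuous_const.mul continuous_id)).tendsto 0
    rw [mul_zero, Real.exp_zero] at h
    exact h.mono_left nhdsWithin_le_nhds
  have hev1 : ∀ᶠ t in 𝓝[>] (0 : ℝ), Real.exp (lam * t) < 1 + η / (2 * M) :=
    hexp (Iio_mem_nhds (lt_add_of_pos_right _ (by positivity)))
  have hev2 : ∀ᶠ t in 𝓝[>] (0 : ℝ), t ∈ Ioo 0 t₀ := Ioo_mem_nhdsGT ht₀
  filter_upwards [hev1, hev2] with t h1 h2 z hz
  have hzIoc : z ∈ Ioc (0 : ℝ) 1 := ⟨ha.trans_le hz.1, hz.2⟩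
  rw [Real.dist_eq, abs_sub_lt_iff]
  constructor
  · -- `z^{1-c} - Y < η`
    have := hlow t h2 z hz
    linarith
  · -- `Y - z^{1-c} < η`: `Y ≤ e^{λ₀ t} z^{1-c} ≤ (1 + η/(2M)) z^{1-c} ≤ z^{1-c} + η/2`
    have hup := exp_mul_initHeat_le hc hc2 hμ h2.1 hzIoc
    have hE : 0 < Real.exp (-(μ * (c - 1) * (2 - c) * t)) := Real.exp_pos _
    have hY : initHeat c μ z t ≤ Real.exp (lam * t) * z ^ (1 - c) := by
      have h3 : Real.exp (lam * t) * (Real.exp (-(μ * (c - 1) * (2 - c) * t)) * initHeat c μ z t)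
          ≤ Real.exp (lam * t) * z ^ (1 - c) :=
        mul_le_mul_of_nonneg_left hup (Real.exp_pos _).le
      have h4 : Real.exp (lam * t) * Real.exp (-(μ * (c - 1) * (2 - c) * t)) = 1 := by
        rw [← Real.exp_add, hlam, show μ * (c - 1) * (2 - c) * t + -(μ * (c - 1) * (2 - c) * t) = 0
          by ring, Real.exp_zero]
      calc initHeat c μ z t = (Real.exp (lam * t) * Real.exp (-(μ * (c - 1) * (2 - c) * t)))
            * initHeat c μ z t := by rw [h4, one_mul]
        _ = Real.exp (lam * t) * (Real.exp (-(μ * (c - 1) * (2 - c) * t)) * initHeat c μ z t) := by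
            ring
        _ ≤ _ := h3
    have h5 : Real.exp (lam * t) * z ^ (1 - c) ≤ (1 + η / (2 * M)) * z ^ (1 - c) :=
      mul_le_mul_of_nonneg_right h1.le (hzpos z hz).le
    have h6 : (1 + η / (2 * M)) * z ^ (1 - c) ≤ z ^ (1 - c) + η / 2 := by
      rw [add_mul, one_mul, add_le_add_iff_left]
      calc η / (2 * M) * z ^ (1 - c) ≤ η / (2 * M) * M :=
            mul_le_mul_of_nonneg_left (hzle z hz) (by positivity)
        _ = η / 2 := by field_simp
    linarith

end SmallTime

end Literature.Analysis.SpecialFunctions
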